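import Literature.NumberTheory.Sieve.MoebiusWalshCircuitsGreenProofs
import Literature.NumberTheory.LFunctions.MoebiusWalshFourierProofs
import HarnessLib

/-!
# Green 2012, Theorem 1 for the Liouville function (`green_liouville_AC0`), proved

Topic `Literature/NumberTheory/Sieve`. Discharge of the named fact
`Literature.NumberTheory.Sieve.green_liouville_AC0` (`MoebiusWalshCircuits.lean`): B. Green,
*On (not) computing the Möbius function using bounded depth circuits*, Combin. Probab. Comput.
**21** (2012) 942–951 (arXiv:1103.4991) [Green2012], Theorem 1, in the `λ`-version of his §1 remark
("All of the results in this paper hold equally well for the Liouville function"): for fixed depth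
`d`, polynomial size and `ε > 0`, eventually in `n`, every `AC⁰` circuit `C` on `n` input bits of
depth `≤ d` and size `≤ p(n)` has `|Σ_{x<2ⁿ} λ(x)·(−1)^{C(x)}| ≤ ε2ⁿ`.

The two halves of Green's proof are in the tree:
* `Literature.NumberTheory.Sieve.green_liouville_AC0_of_fourierWalsh`
  (`MoebiusWalshCircuitsGreenProofs.lean`): Linial–Mansour–Nisan in Tal's sharp form (the tree's
  `Literature.Computability.Complexity` Fourier-tail bounds) reduces Theorem 1 to Proposition 1;
* `Literature.NumberTheory.LFunctions.green_liouville_fourierWalsh_holds`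
  (`LFunctions/MoebiusWalshFourierProofs.lean`): Proposition 1 for `λ` (Kátai's argument,
  Harman–Kátai's lemma, the minor-arc bound for `μ`, and Green's Theorem 3 on characters to
  `2`-power moduli).

## References

* B. Green, *On (not) computing the Möbius function using bounded depth circuits*, Combin. Probab.
  Comput. 21 (2012) 942–951, Theorem 1 and Proposition 1 [Green2012].
-/

namespace Literature.NumberTheory.Sieve

/-- **Green 2012, Theorem 1 for `λ`** (discharge of `green_liouville_AC0`): the Liouville function
is asymptotically orthogonal to every polynomial-size `AC⁰(d)` Boolean function of the binary
digits. Proof: `green_liouville_AC0_of_fourierWalsh` (Linial–Mansour–Nisan/Tal reduction to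
Proposition 1) applied to `green_liouville_fourierWalsh_holds` (Proposition 1 for `λ`).
[cite: Green2012, Theorem 1; §1 (remark on `λ`)] -/
theorem green_liouville_AC0_holds : green_liouville_AC0 :=
  green_liouville_AC0_of_fourierWalsh
    Literature.NumberTheory.LFunctions.green_liouville_fourierWalsh_holds

end Literature.NumberTheory.Sieve
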